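import Summits.QuantumFields.YangMills.Theorems.BalabanUVNodesN15CurvedGluingSmoothCutDressedGluedGaugedUNClose
import Summits.QuantumFields.YangMills.Theorems.BalabanUVNodesN15PerCubeGreenJetCubesClose
import HarnessLib

/-!
# N15 = NE2, road (c) — PROGRAMME (PC), towards (PC-D) «the per-cube LANDAU LETTER»: WALK LOCALITY OF A LEFT FACTOR THROUGH THE GLUED PROPAGATOR OF `Δ_{R_U} + P` IN UNITARY
# PER-CUBE SITE GAUGES, CLOSE NEAR DATA — dag-n15-w3 52's `U(N)` discharges for two families of gauge data and TWO LEFT FACTORS of displayed covariance (dag-n15-c g29, n15-c∕302)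

Cell `pub-ymgap`, seat `pub-ymgap-dag-n15-c` (generation g29; R134 (a), s1; HUMAN RULING D-0062).  `bears_on: R4∕N15 · K3⁸ SpineGivenEndpointR13SepCoPHV (stmt-QuantumFields-27366)`;
filed `--kind proof --supports stmt-QuantumFields-27366 --as helper` — COUNT-NEUTRAL.  One theorem; 0 `def`, 0 `sorry`.  GENERATED from the TREE texts of n15-c∕294
`…CurvedGluingSmoothCutDressedGluedGaugedUNClose` (statement + FILE 52's discharges for both families, VERBATIM) and n15-c∕272 `…PerCubeGreenJetCubesUN` (the left-factor binder
block), closed by n15-c∕301 `hasMaj_comp_glueInv_sub_smoothCutDressed_localGauges_close`; imports 294 and 301 BY NAME (through them dag-n15-w2 `uN_siteGauge_orthogonal`,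
`uN_localOp_species_form`, files 49–51 `localOp_eq_cut_add_farDefect`, `hasMaj_cutPert_structural_of_local`, `hasMaj_mulOp_farDefect_smoothCutDressed`, `hasMaj_commOp_farDefect_structural`).
Nothing in the tree is modified, no landed name re-declared.

WHY.  n15-c∕295 (`uN_scGlued_sub_scGlued_spec`, the site knit behind `G′(V) − G′(𝟙)` of n15-c∕296) is the SITE INSTANTIATION of n15-c∕294.  The per-cube Landau letter of (PC-D) needs the
same with the covariant gradient in front — `D_VG′(V) − ∂G′(𝟙)` — i.e. «294 with two left factors»: THIS FILE, whose binder list is 294's + 272's jet block + the second left factor, so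
that the site instantiation (next file) is n15-c∕295's generator with n15-c∕273∕274's jet arguments appended for both families (`D := D_{U,μ}`, `D♭ := D_{U♭,μ}`; covariance
n15-c∕270 `covD_comp_mmulOp_transpose`, species split `covD_eq_fgrad_add` under ∕ beyond the cut).

WHAT.  ★★★ `uN_hasMaj_comp_glueInv_sub_smoothCutDressed_localGauges_close`: n15-c∕294's hypotheses (two families `(u_k, U, P = N_L − N_V k)`, `(u♭_k, U♭, P♭ = N_L − N♭_V k)`, same
letters, `u♭ = u` off `Far`, `S_k ⊆ Z` on `Far`, `8σ ≤ ρ₃`) + the two left factors `D`, `D♭` (same Leibniz letters `c_s, c_d`; covariances `D∘M_{W_kᵀ} = M_{v_kᵀ}∘(∇_j + P^sp_k + P^far_k)`,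
`D♭∘M_{W♭_kᵀ} = M_{v♭_kᵀ}∘(∇_j + P♭^sp_k + P♭^far_k)`, `W_k = coordMat e Ad_{u_k}`; `P^sp, P♭^sp ≤ 1_{S_k}(y)r_Pe^{−ρ_Pd}`; far parts killed by `M_{χ_k}`; `v♭ = v` off `Far`) ⟹
`D∘𝒢 − D♭∘𝒢♭ ≤` n15-c∕301's majorant with FILE 52's letters (`θ_F ↦ θ_Fβ̄′c_r`, `ε_F ↦ 0`, `R_c ↦ r_V(1 + |J ⊕ J|) + R_N`).

HONEST FRAMING ∕ LIMITS.  Composition of LANDED theorems over DISPLAYED rows; proves NO estimate of a concrete propagator; [B9] (3.34)–(3.35) p.396, (3.42) p.397, (3.52) p.400,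
(3.62)–(3.65) pp.402–403, Cor. 3.8 p.410, Thm 3.14 pp.426–427 and [B6] (2.91)–(2.93) p.239, (2.133)–(2.136) p.247 cited for SHAPES ∕ MECHANISM.  NE2⁺ NOT PRINTED, NOT proved; N15 of
record untouched (DISCHARGED AS CONSUMED, p687738); K3⁸ OPEN; counts UNMOVED; one finite 𝕋⁴ at fixed ε — NOT infinite volume, NOT OS on ℝ⁴, NOT a mass gap, NOT Clay.  Restate-immune.
-/

set_option autoImplicit false

noncomputable section
open scoped BigOperators Matrix Matrix.Norms.Frobenius
open Finset

namespace Summit.QuantumFields.YangMills.BalabanUVNodes.N15.CurvedSpecies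

open Literature.MathematicalPhysics.QuantumFieldTheory.Balaban1983to89
open Literature.MathematicalPhysics.QuantumFieldTheory.Balaban1983to89.B11SectG (BlockNorm HasMaj RowSum hasMaj_zero)
open Literature.MathematicalPhysics.QuantumFieldTheory.Balaban1983to89.B6RandomWalk (Triangle254)
open Literature.MathematicalPhysics.QuantumFieldTheory.Balaban1983to89.B6Prop26Gluing (mulOp mulOp_apply ind ind_nonneg ind_le_one)
open Summit.QuantumFields.YangMills.BalabanUVNodes.N15.MatrixSpecies (mmulOp liftBlk liftEquiv liftEquiv_apply liftEquiv_symm_apply coordMat)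
open Summit.QuantumFields.YangMills.BalabanUVNodes.N15.BackgroundLayer (fgrad bgrad fgradAdj stack projO blkPair bgPropV covLapM tCoefA tCoefC unstackM projO_none_comp_stack)
open Summit.QuantumFields.YangMills.BalabanUVNodes.N15.Gluing (commOp lapOp parametrix remainder glueInv)
open Literature.Barriers.QuantumFields (traceForm)

variable {X ι J K : Type} [Fintype X] [DecidableEq X] [Fintype ι] [DecidableEq ι] [Fintype J] [DecidableEq J] [Fintype K] {g : B6.Geometry} (blk : X → g.Site) (τ : J → X ≃ X)
  {σ cr : ℝ} {N : K → (X × ι → ℝ) →ₗ[ℝ] (X × ι → ℝ)} {NL : (X × ι → ℝ) →ₗ[ℝ] (X × ι → ℝ)}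
  {χX χtX ψX hX : K → X → ℝ} {Sk : K → Set g.Site} {hb : K → g.Site → ℝ} {β β₁ ct δ : ℝ}
set_option maxHeartbeats 800000 in
/-- ★★★ **WALK LOCALITY OF A LEFT FACTOR THROUGH THE GLUED PROPAGATOR OF `Δ_{R_U} + P` IN UNITARY PER-CUBE SITE GAUGES, CLOSE NEAR DATA** — n15-c∕294's hypotheses (ONE set of flat
smooth-cut cubes, cuts, partition, tails, flat nonlocal summand `N_L`; TWO families `(u_k, U, P = N_L − N_V k)`, `(u♭_k, U♭, P♭ = N_L − N♭_V k)` with the same letters, (3.35) on each cube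
WHERE `χ_k ≠ 0`, `u♭_k = u_k` off `Far`, `S_k ⊆ Z` on `Far`, `8σ ≤ ρ₃`) and TWO LEFT FACTORS `D`, `D♭` with the same Leibniz letters and displayed covariances in the families' gauges
(`D∘M_{W_kᵀ} = M_{v_kᵀ}∘(∇_j + P^sp_k + P^far_k)`, `D♭∘M_{W♭_kᵀ} = M_{v♭_kᵀ}∘(∇_j + P♭^sp_k + P♭^far_k)`, `v♭ = v` off `Far`) ⟹ `D∘𝒢 − D♭∘𝒢♭ ≤ [C_near + C_far·e^{−(ρ₃∕4−σ)d_Z(y)}]·e^{−(ρ₃∕4−2σ)d}`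
(FILE 52's discharges for both families VERBATIM, then n15-c∕301). [cite: Balaban1985BackgroundPropagators, (3.34)–(3.35) p.396, (3.42) p.397 (gradient entries: shape), (3.52) p.400, (3.62)–(3.65) pp.402–403, Cor. 3.8 p.410, Thm 3.14 pp.426–427 (mechanism); Balaban1984PropagatorsII, (2.91)–(2.93) p.239, (2.133)–(2.136) p.247] -/
theorem uN_hasMaj_comp_glueInv_sub_smoothCutDressed_localGauges_close {m : Type} [Fintype m] [DecidableEq m] (e : Matrix m m ℂ ≃L[ℝ] (ι → ℝ)) {u : K → X → Matrix m m ℂ} {U : J → X → Matrix m m ℂ}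
    {P : (X × ι → ℝ) →ₗ[ℝ] (X × ι → ℝ)} {NV : K → (X × ι → ℝ) →ₗ[ℝ] (X × ι → ℝ)} (η : ℝ) (Far : K → Prop) [DecidablePred Far] (Z : Set g.Site) (dZ : g.Site → ℝ) (htri : Triangle254 g) (hd : ∀ a b : g.Site, 0 ≤ g.dist a b) (hd0 : ∀ y : g.Site, g.dist y y = 0) (hsymm : ∀ y y', g.dist y y' = g.dist y' y) (hdZ : ∀ y z, z ∈ Z → dZ y ≤ g.dist y z) (hdZ0 : ∀ y, 0 ≤ dZ y)
    (hrow : RowSum g σ cr) (hσ : 0 ≤ σ) {ρ₁ ρ₂ ρ₃ ρN ρT δV ε R ε₀ c₁ c₂ θW cN ℓ ω d₁ Nov : ℝ} (hβ : 0 ≤ β) (hβ₁ : 0 ≤ β₁) (hct : 0 ≤ ct) (hR : 0 ≤ R) (hε₀ : 0 ≤ ε₀) (hcr : 0 ≤ cr) (hNov : 0 ≤ Nov) (hσρ : σ ≤ ρ₁) (hρ₁V : ρ₁ ≤ δV)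
    (hρ₁G : ρ₁ + σ ≤ δ) (hρ₂ : 0 ≤ ρ₂) (hρ₂₁ : ρ₂ + σ ≤ ρ₁) (hρ₂T : ρ₂ + σ ≤ ρT) (hρ₃ : 0 ≤ ρ₃) (hρ₃₂ : ρ₃ ≤ ρ₂) (hρ₃V : ρ₃ + σ ≤ δV - ε) (hρ₃N : ρ₃ + σ ≤ ρN) (hσρ₃ : 8 * σ ≤ ρ₃)
    (hε : 0 < ε) (hc₁ : 0 ≤ c₁) (hc₂ : 0 ≤ c₂) (hθW : 0 ≤ θW) (hcN : 0 ≤ cN) (hℓ : 0 ≤ ℓ) (hω : 0 ≤ ω) (hd₁ : 0 ≤ d₁)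
    -- per cube: supports, the bump and its insertions (both ways), the input cut-off
    (hSχ : ∀ k x, χX k x ≠ 0 → blk x ∈ Sk k) (hSψ : ∀ k x, ψX k x ≠ 0 → blk x ∈ Sk k) (hχt : ∀ k x, |χtX k x| ≤ 1)
    (hdχt : ∀ k μ p, |fgrad η⁻¹ (liftEquiv (τ μ) ι) (fun p : X × ι => χtX k p.1) p| ≤ ct) (hdχtb : ∀ k μ p, |bgrad η⁻¹ (liftEquiv (τ μ) ι) (fun p : X × ι => χtX k p.1) p| ≤ ct)
    (hsub : ∀ k, mulOp (fun p : X × ι => χtX k p.1) ∘ₗ mulOp (fun p : X × ι => χX k p.1) = mulOp (fun p : X × ι => χtX k p.1))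
    (hχ : ∀ k, mulOp (fun p : X × ι => χX k p.1) ∘ₗ mulOp (fun p : X × ι => χtX k p.1) = mulOp (fun p : X × ι => χtX k p.1))
    (hs : ∀ k μ, mulOp ((fun p : X × ι => χtX k p.1) ∘ (liftEquiv (τ μ) ι)) ∘ₗ mulOp (fun p : X × ι => χX k p.1) = mulOp ((fun p : X × ι => χtX k p.1) ∘ (liftEquiv (τ μ) ι)))
    (hsb : ∀ k μ, mulOp ((fun p : X × ι => χtX k p.1) ∘ (liftEquiv (τ μ) ι).symm) ∘ₗ mulOp (fun p : X × ι => χX k p.1) = mulOp ((fun p : X × ι => χtX k p.1) ∘ (liftEquiv (τ μ) ι).symm))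
    (hdd : ∀ k μ, mulOp (fgrad η⁻¹ (liftEquiv (τ μ) ι) (fun p : X × ι => χtX k p.1)) ∘ₗ mulOp (fun p : X × ι => χX k p.1) = mulOp (fgrad η⁻¹ (liftEquiv (τ μ) ι) (fun p : X × ι => χtX k p.1)))
    (hddb : ∀ k μ, mulOp (bgrad η⁻¹ (liftEquiv (τ μ) ι) (fun p : X × ι => χtX k p.1)) ∘ₗ mulOp (fun p : X × ι => χX k p.1) = mulOp (bgrad η⁻¹ (liftEquiv (τ μ) ι) (fun p : X × ι => χtX k p.1)))
    (hs' : ∀ k μ, mulOp (fun p : X × ι => χX k p.1) ∘ₗ mulOp ((fun p : X × ι => χtX k p.1) ∘ (liftEquiv (τ μ) ι)) = mulOp ((fun p : X × ι => χtX k p.1) ∘ (liftEquiv (τ μ) ι)))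
    (hsb' : ∀ k μ, mulOp (fun p : X × ι => χX k p.1) ∘ₗ mulOp ((fun p : X × ι => χtX k p.1) ∘ (liftEquiv (τ μ) ι).symm) = mulOp ((fun p : X × ι => χtX k p.1) ∘ (liftEquiv (τ μ) ι).symm))
    (hdd' : ∀ k μ, mulOp (fun p : X × ι => χX k p.1) ∘ₗ mulOp (fgrad η⁻¹ (liftEquiv (τ μ) ι) (fun p : X × ι => χtX k p.1)) = mulOp (fgrad η⁻¹ (liftEquiv (τ μ) ι) (fun p : X × ι => χtX k p.1)))
    (hddb' : ∀ k μ, mulOp (fun p : X × ι => χX k p.1) ∘ₗ mulOp (bgrad η⁻¹ (liftEquiv (τ μ) ι) (fun p : X × ι => χtX k p.1)) = mulOp (bgrad η⁻¹ (liftEquiv (τ μ) ι) (fun p : X × ι => χtX k p.1)))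
    (hNψ : ∀ k, N k ∘ₗ mulOp (fun p : X × ι => ψX k p.1) = N k)
    -- per cube: FILE 63's cut rows
    (hcut : ∀ k, HasMaj (BlockNorm.ofBlocks g (liftBlk blk ι)) (BlockNorm.ofBlocks g (liftBlk blk ι)) (mulOp (fun p : X × ι => χX k p.1) ∘ₗ N k) (fun y y' => ind (Sk k) y * ind (Sk k) y' * (β * Real.exp (-(δ * g.dist y y')))))
    (hcutF : ∀ k μ, HasMaj (BlockNorm.ofBlocks g (liftBlk blk ι)) (BlockNorm.ofBlocks g (liftBlk blk ι)) (mulOp (fun p : X × ι => χX k p.1) ∘ₗ (fgrad η⁻¹ (liftEquiv (τ μ) ι) ∘ₗ N k)) (fun y y' => ind (Sk k) y * ind (Sk k) y' * (β₁ * Real.exp (-(δ * g.dist y y')))))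
    (hcutB : ∀ k μ, HasMaj (BlockNorm.ofBlocks g (liftBlk blk ι)) (BlockNorm.ofBlocks g (liftBlk blk ι)) (mulOp (fun p : X × ι => χX k p.1) ∘ₗ (bgrad η⁻¹ (liftEquiv (τ μ) ι) ∘ₗ N k)) (fun y y' => ind (Sk k) y * ind (Sk k) y' * (β₁ * Real.exp (-(δ * g.dist y y')))))
    -- per cube: the partition (`|h| ≤ 1`, `Σh² = 1`, supported in the cut: `M_hM_χ = M_h`, letters `c₁, c₂`, block reading `hb` with `ℓ, ω`), one-step block distance `d₁`, overlap `N_ov`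
    (hhabs : ∀ k x, |hX k x| ≤ 1) (hhcut : ∀ k, mulOp (fun p : X × ι => hX k p.1) ∘ₗ mulOp (fun p : X × ι => χX k p.1) = mulOp (fun p : X × ι => hX k p.1))
    (hh1 : ∀ k μ p, |fgrad η⁻¹ (liftEquiv (τ μ) ι) (fun p : X × ι => hX k p.1) p| ≤ c₁) (hh1b : ∀ k μ p, |bgrad η⁻¹ (liftEquiv (τ μ) ι) (fun p : X × ι => hX k p.1) p| ≤ c₁) (hh2 : ∀ k μ p, |fgradAdj η⁻¹ (liftEquiv (τ μ) ι) (fgrad η⁻¹ (liftEquiv (τ μ) ι) (fun p : X × ι => hX k p.1)) p| ≤ c₂)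
    (hLip : ∀ k y y', |hb k y - hb k y'| ≤ ℓ * g.dist y y') (hrh : ∀ k (p : X × ι), |hX k p.1 - hb k (liftBlk blk ι p)| ≤ ω) (hstep : ∀ μ x, g.dist (blk (τ μ x)) (blk x) ≤ d₁)
    (hN : ∀ a, ∑ k, ind (Sk k) a ≤ Nov)
    -- per cube: the tail row (dag-n15-a's images geometry ∕ FILE 68's far sandwich)
    (hT : ∀ k, HasMaj (BlockNorm.ofBlocks g (liftBlk blk ι)) (BlockNorm.ofBlocks g (liftBlk blk ι)) ((-(mulOp (fun p : X × ι => hX k p.1) ∘ₗ NL ∘ₗ mulOp (1 - fun p : X × ι => χtX k p.1))) ∘ₗ N k) (fun y y' => ind (Sk k) y * ind (Sk k) y' * (ε₀ * Real.exp (-(ρT * g.dist y y')))))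
    (hq : (β + (β₁ + ct * β)) * (R * cr) * cr < 1)
    (hKN : ∀ k, HasMaj (BlockNorm.ofBlocks g (liftBlk blk ι)) (BlockNorm.ofBlocks g (liftBlk blk ι)) (commOp NL (fun p : X × ι => hX k p.1)) (fun y y' => cN * Real.exp (-(ρN * g.dist y y'))))
    -- THE GAUGE GROUP OF RECORD: trace-form coordinates `e` of `𝔤 = 𝔲(m)`, unitary per-cube site gauges `u_k`, unitary bond variables `U`, Bałaban's nonlocal summand `P` read in cube `k`'s
    -- gauge as the flat `N_L` minus a per-cube nonlocal perturbation `N_V k`; the species of the transformed bond variables SMALL WHERE `χ_k ≠ 0` ((3.35) on the cube); letters of `N_V k`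
    (he : ∀ A B : Matrix m m ℂ, traceForm A B = e A ⬝ᵥ e B) (hu : ∀ k x, (u k x)ᴴ * u k x = 1) {rV RN θF ρF : ℝ} (hrV : 0 ≤ rV) (hRN : 0 ≤ RN) (hθF : 0 ≤ θF) (hρF : ρ₃ + σ ≤ ρF)
    (hRle : rV * (1 + Fintype.card (J ⊕ J)) + RN ≤ R)
    (hP : ∀ k, mmulOp (fun x => coordMat e (ContinuousLinearMap.mulLeftRight ℝ (Matrix m m ℂ) (u k x) (u k x)ᴴ)) ∘ₗ P ∘ₗ mmulOp (fun x => (coordMat e (ContinuousLinearMap.mulLeftRight ℝ (Matrix m m ℂ) (u k x) (u k x)ᴴ))ᵀ) = NL - NV k)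
    (hχ1 : ∀ k x, |χX k x| ≤ 1) (hψχ : ∀ k, mulOp (fun p : X × ι => ψX k p.1) ∘ₗ mulOp (fun p : X × ι => χX k p.1) = mulOp (fun p : X × ι => χX k p.1))
    (hCloc : ∀ k x, χX k x ≠ 0 → ∀ i, ∑ j, |tCoefC η (gaugePair τ fun μ x => coordMat e (ContinuousLinearMap.mulLeftRight ℝ (Matrix m m ℂ) (u k x * U μ x * (u k (τ μ x))ᴴ) (u k x * U μ x * (u k (τ μ x))ᴴ)ᴴ)) x i j| ≤ rV)
    (hAloc : ∀ k j' x, χX k x ≠ 0 → ∀ i, ∑ j, |tCoefA η (gaugePair τ fun μ x => coordMat e (ContinuousLinearMap.mulLeftRight ℝ (Matrix m m ℂ) (u k x * U μ x * (u k (τ μ x))ᴴ) (u k x * U μ x * (u k (τ μ x))ᴴ)ᴴ)) j' x i j| ≤ rV)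
    (hNVcut : ∀ k, HasMaj (BlockNorm.ofBlocks g (liftBlk blk ι)) (BlockNorm.ofBlocks g (liftBlk blk ι)) (mulOp (fun p : X × ι => ψX k p.1) ∘ₗ NV k ∘ₗ mulOp (fun p : X × ι => χX k p.1)) (fun y y' => RN * Real.exp (-(δV * g.dist y y'))))
    (hfarN : ∀ k, HasMaj (BlockNorm.ofBlocks g (liftBlk blk ι)) (BlockNorm.ofBlocks g (liftBlk blk ι)) ((LinearMap.id - mulOp (fun p : X × ι => ψX k p.1)) ∘ₗ NV k ∘ₗ mulOp (fun p : X × ι => χX k p.1)) (fun y y' => θF * Real.exp (-(ρF * g.dist y y'))))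
    -- supports of the partition inside `ψ_k` and `χ_k` (with shifts and differences)
    (hhψ : ∀ k, mulOp (fun p : X × ι => hX k p.1) ∘ₗ mulOp (fun p : X × ι => ψX k p.1) = mulOp (fun p : X × ι => hX k p.1)) (hχh : ∀ k, mulOp (fun p : X × ι => χX k p.1) ∘ₗ mulOp (fun p : X × ι => hX k p.1) = mulOp (fun p : X × ι => hX k p.1))
    (hhs' : ∀ k μ, mulOp (fun p : X × ι => χX k p.1) ∘ₗ mulOp ((fun p : X × ι => hX k p.1) ∘ (liftEquiv (τ μ) ι)) = mulOp ((fun p : X × ι => hX k p.1) ∘ (liftEquiv (τ μ) ι)))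
    (hhsb' : ∀ k μ, mulOp (fun p : X × ι => χX k p.1) ∘ₗ mulOp ((fun p : X × ι => hX k p.1) ∘ (liftEquiv (τ μ) ι).symm) = mulOp ((fun p : X × ι => hX k p.1) ∘ (liftEquiv (τ μ) ι).symm))
    (hhdd' : ∀ k μ, mulOp (fun p : X × ι => χX k p.1) ∘ₗ mulOp (fgrad η⁻¹ (liftEquiv (τ μ) ι) (fun p : X × ι => hX k p.1)) = mulOp (fgrad η⁻¹ (liftEquiv (τ μ) ι) (fun p : X × ι => hX k p.1)))
    (hhddb' : ∀ k μ, mulOp (fun p : X × ι => χX k p.1) ∘ₗ mulOp (bgrad η⁻¹ (liftEquiv (τ μ) ι) (fun p : X × ι => hX k p.1)) = mulOp (bgrad η⁻¹ (liftEquiv (τ μ) ι) (fun p : X × ι => hX k p.1)))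
    (hq' : Nov * ((Fintype.card ι : ℝ) ^ 2 * ((((Fintype.card J : ℝ) * (c₂ * ((β + (β₁ + ct * β)) * (1 - (β + (β₁ + ct * β)) * (R * cr) * cr)⁻¹) + 2 * (c₁ * ((β + (β₁ + ct * β)) * (1 - (β + (β₁ + ct * β)) * (R * cr) * cr)⁻¹))) + θW + cN * ((β + (β₁ + ct * β)) * (1 - (β + (β₁ + ct * β)) * (R * cr) * cr)⁻¹) * cr)
          + ((ℓ * (Real.exp 1 * ε)⁻¹ + 2 * (ω + ℓ * d₁)) * R * ((β + (β₁ + ct * β)) * (1 - (β + (β₁ + ct * β)) * (R * cr) * cr)⁻¹) * cr + R * c₁ * ((β + (β₁ + ct * β)) * (1 - (β + (β₁ + ct * β)) * (R * cr) * cr)⁻¹) * cr)) + (θF * (1 * ((β + (β₁ + ct * β)) * (1 - (β + (β₁ + ct * β)) * (R * cr) * cr)⁻¹)) * cr)) + (Fintype.card ι : ℝ) ^ 2 * ((ε₀ * (1 - (β + (β₁ + ct * β)) * (R * cr) * cr)⁻¹) + 0)) * cr < 1)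
    -- THE SECOND FAMILY: unitary site gauges `u♭_k`, bond variables `U♭`, nonlocal summand `P♭` read as `N_L − N♭_V k`, the same letters; EQUAL site gauges off `Far`, far regions in `Z`
    {u₂ : K → X → Matrix m m ℂ} {U₂ : J → X → Matrix m m ℂ} {P₂ : (X × ι → ℝ) →ₗ[ℝ] (X × ι → ℝ)} {NV₂ : K → (X × ι → ℝ) →ₗ[ℝ] (X × ι → ℝ)} (hu₂ : ∀ k x, (u₂ k x)ᴴ * u₂ k x = 1)
    (hP₂ : ∀ k, mmulOp (fun x => coordMat e (ContinuousLinearMap.mulLeftRight ℝ (Matrix m m ℂ) (u₂ k x) (u₂ k x)ᴴ)) ∘ₗ P₂ ∘ₗ mmulOp (fun x => (coordMat e (ContinuousLinearMap.mulLeftRight ℝ (Matrix m m ℂ) (u₂ k x) (u₂ k x)ᴴ))ᵀ) = NL - NV₂ k)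
    (hCloc₂ : ∀ k x, χX k x ≠ 0 → ∀ i, ∑ j, |tCoefC η (gaugePair τ fun μ x => coordMat e (ContinuousLinearMap.mulLeftRight ℝ (Matrix m m ℂ) (u₂ k x * U₂ μ x * (u₂ k (τ μ x))ᴴ) (u₂ k x * U₂ μ x * (u₂ k (τ μ x))ᴴ)ᴴ)) x i j| ≤ rV)
    (hAloc₂ : ∀ k j' x, χX k x ≠ 0 → ∀ i, ∑ j, |tCoefA η (gaugePair τ fun μ x => coordMat e (ContinuousLinearMap.mulLeftRight ℝ (Matrix m m ℂ) (u₂ k x * U₂ μ x * (u₂ k (τ μ x))ᴴ) (u₂ k x * U₂ μ x * (u₂ k (τ μ x))ᴴ)ᴴ)) j' x i j| ≤ rV)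
    (hNVcut₂ : ∀ k, HasMaj (BlockNorm.ofBlocks g (liftBlk blk ι)) (BlockNorm.ofBlocks g (liftBlk blk ι)) (mulOp (fun p : X × ι => ψX k p.1) ∘ₗ NV₂ k ∘ₗ mulOp (fun p : X × ι => χX k p.1)) (fun y y' => RN * Real.exp (-(δV * g.dist y y'))))
    (hfarN₂ : ∀ k, HasMaj (BlockNorm.ofBlocks g (liftBlk blk ι)) (BlockNorm.ofBlocks g (liftBlk blk ι)) ((LinearMap.id - mulOp (fun p : X × ι => ψX k p.1)) ∘ₗ NV₂ k ∘ₗ mulOp (fun p : X × ι => χX k p.1)) (fun y y' => θF * Real.exp (-(ρF * g.dist y y'))))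
    (hZ : ∀ k, Far k → Sk k ⊆ Z) (huu : ∀ k, ¬Far k → u₂ k = u k)
    -- THE LEFT FACTOR (n15-c∕269): a jet index, the global operator `D`, its Leibniz rule through the partition, its GAUGE COVARIANCE `D∘M_{W_kᵀ} = M_{v_kᵀ}∘(∇_j + P^sp_k + P^far_k)`
    -- (`W_k = coordMat e Ad_{u_k}`), the species part `P^sp_k` (output-localized on the cube's region, small) and the far part `P^far_k` (annihilated by the cube's cut-off)
    (jj : J ⊕ J) {Dg : (X × ι → ℝ) →ₗ[ℝ] (X × ι → ℝ)} {vg : K → X → Matrix ι ι ℝ} {Psp Pfar : K → (X × ι → ℝ) →ₗ[ℝ] (X × ι → ℝ)} {hsX dhX : K → X → ℝ} {cs cd rP ρP : ℝ}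
    (hcs : 0 ≤ cs) (hcd : 0 ≤ cd) (hrP : 0 ≤ rP) (hρP : ρ₃ + σ ≤ ρP) (hvg' : ∀ k x, (vg k x)ᵀ * vg k x = 1)
    (hDcov : ∀ k, Dg ∘ₗ mmulOp (fun x => (coordMat e (ContinuousLinearMap.mulLeftRight ℝ (Matrix m m ℂ) (u k x) (u k x)ᴴ))ᵀ) = mmulOp (fun x => (vg k x)ᵀ) ∘ₗ (Sum.elim (fun μ => fgrad η⁻¹ (liftEquiv (τ μ) ι)) (fun μ => bgrad η⁻¹ (liftEquiv (τ μ) ι)) jj + Psp k + Pfar k))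
    (hDleib : ∀ k, Dg ∘ₗ mulOp (fun p : X × ι => hX k p.1) = mulOp (fun p : X × ι => hsX k p.1) ∘ₗ Dg + mulOp (fun p : X × ι => dhX k p.1))
    (hhs : ∀ k (p : X × ι), |hsX k p.1| ≤ cs) (hdh : ∀ k (p : X × ι), |dhX k p.1| ≤ cd)
    (hPsp : ∀ k, HasMaj (BlockNorm.ofBlocks g (liftBlk blk ι)) (BlockNorm.ofBlocks g (liftBlk blk ι)) (Psp k) (fun y y' => ind (Sk k) y * (rP * Real.exp (-(ρP * g.dist y y')))))
    (hPfar : ∀ k, Pfar k ∘ₗ mulOp (fun p : X × ι => χX k p.1) = 0)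
    -- THE SECOND LEFT FACTOR `D♭` (same Leibniz letters): its covariance in the gauges `u♭_k` with the orthogonal family `v♭_k`, species part `P♭^sp_k`, far part `P♭^far_k`;
    -- on the cubes not `Far` the covariance families agree
    {Dg₂ : (X × ι → ℝ) →ₗ[ℝ] (X × ι → ℝ)} {vg₂ : K → X → Matrix ι ι ℝ} {Psp₂ Pfar₂ : K → (X × ι → ℝ) →ₗ[ℝ] (X × ι → ℝ)} (hvg₂' : ∀ k x, (vg₂ k x)ᵀ * vg₂ k x = 1)
    (hDcov₂ : ∀ k, Dg₂ ∘ₗ mmulOp (fun x => (coordMat e (ContinuousLinearMap.mulLeftRight ℝ (Matrix m m ℂ) (u₂ k x) (u₂ k x)ᴴ))ᵀ) = mmulOp (fun x => (vg₂ k x)ᵀ) ∘ₗ (Sum.elim (fun μ => fgrad η⁻¹ (liftEquiv (τ μ) ι)) (fun μ => bgrad η⁻¹ (liftEquiv (τ μ) ι)) jj + Psp₂ k + Pfar₂ k))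
    (hDleib₂ : ∀ k, Dg₂ ∘ₗ mulOp (fun p : X × ι => hX k p.1) = mulOp (fun p : X × ι => hsX k p.1) ∘ₗ Dg₂ + mulOp (fun p : X × ι => dhX k p.1))
    (hPsp₂ : ∀ k, HasMaj (BlockNorm.ofBlocks g (liftBlk blk ι)) (BlockNorm.ofBlocks g (liftBlk blk ι)) (Psp₂ k) (fun y y' => ind (Sk k) y * (rP * Real.exp (-(ρP * g.dist y y')))))
    (hPfar₂ : ∀ k, Pfar₂ k ∘ₗ mulOp (fun p : X × ι => χX k p.1) = 0) (hvv : ∀ k, ¬Far k → vg₂ k = vg k) :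
    HasMaj (BlockNorm.ofBlocks g (liftBlk blk ι)) (BlockNorm.ofBlocks g (liftBlk blk ι))
      (Dg ∘ₗ glueInv (parametrix (fun k (p : X × ι) => hX k p.1) (fun k => mmulOp (fun x => (coordMat e (ContinuousLinearMap.mulLeftRight ℝ (Matrix m m ℂ) (u k x) (u k x)ᴴ))ᵀ) ∘ₗ (projO none ∘ₗ bgPropV (stack (mulOp (fun p : X × ι => χtX k p.1) ∘ₗ N k) (fun j => Sum.elim (fun μ => fgrad η⁻¹ (liftEquiv (τ μ) ι)) (fun μ => bgrad η⁻¹ (liftEquiv (τ μ) ι)) j ∘ₗ (mulOp (fun p : X × ι => χtX k p.1) ∘ₗ N k))) (mulOp (fun p : X × ι => ψX k p.1) ∘ₗ (unstackM (tCoefC η (gaugePair τ fun μ x => coordMat e (ContinuousLinearMap.mulLeftRight ℝ (Matrix m m ℂ) (u k x * U μ x * (u k (τ μ x))ᴴ) (u k x * U μ x * (u k (τ μ x))ᴴ)ᴴ))) (tCoefA η (gaugePair τ fun μ x => coordMat e (ContinuousLinearMap.mulLeftRight ℝ (Matrix m m ℂ) (u k x * U μ x * (u k (τ μ x))ᴴ)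 (u k x * U μ x * (u k (τ μ x))ᴴ)ᴴ))) + NV k ∘ₗ projO none) ∘ₗ mulOp (fun q : (X × ι) × Option (J ⊕ J) => χX k q.1.1))) ∘ₗ mmulOp (fun x => coordMat e (ContinuousLinearMap.mulLeftRight ℝ (Matrix m m ℂ) (u k x) (u k x)ᴴ)))) (remainder (covLapM τ η (gaugePair τ (fun μ x => coordMat e (ContinuousLinearMap.mulLeftRight ℝ (Matrix m m ℂ) (U μ x) (U μ x)ᴴ))) + P) (fun k (p : X × ι) => hX k p.1) (fun k => mmulOp (fun x => (coordMat e (ContinuousLinearMap.mulLeftRight ℝ (Matrix m m ℂ) (u k x) (u k x)ᴴ))ᵀ) ∘ₗ (projO none ∘ₗ bgPropV (stack (mulOp (fun p : X × ι => χtX k p.1) ∘ₗ N k) (fun j => Sum.elim (fun μ => fgrad η⁻¹ (liftEquiv (τ μ) ι)) (fun μ => bgrad η⁻¹ (liftEquiv (τ μ) ι)) j ∘ₗ (mulOp (fun p : X × ι => χtX k p.1) ∘ₗ N k))) (mulOp (fun p : X × ι => ψX k p.1) ∘ₗ (unstackM (tCoefC η (gaugePair τ fun μ x => coordMat e (ContinuousLinearMap.mulLeftRight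 ℝ (Matrix m m ℂ) (u k x * U μ x * (u k (τ μ x))ᴴ) (u k x * U μ x * (u k (τ μ x))ᴴ)ᴴ))) (tCoefA η (gaugePair τ fun μ x => coordMat e (ContinuousLinearMap.mulLeftRight ℝ (Matrix m m ℂ) (u k x * U μ x * (u k (τ μ x))ᴴ) (u k x * U μ x * (u k (τ μ x))ᴴ)ᴴ))) + NV k ∘ₗ projO none) ∘ₗ mulOp (fun q : (X × ι) × Option (J ⊕ J) => χX k q.1.1))) ∘ₗ mmulOp (fun x => coordMat e (ContinuousLinearMap.mulLeftRight ℝ (Matrix m m ℂ) (u k x) (u k x)ᴴ))) - ∑ k, (mmulOp (fun x => (coordMat e (ContinuousLinearMap.mulLeftRight ℝ (Matrix m m ℂ) (u k x) (u k x)ᴴ))ᵀ) ∘ₗ ((((-(mulOp (fun p : X × ι => hX k p.1) ∘ₗ NL ∘ₗ mulOp (1 - fun p : X × ι => χtX k p.1))) ∘ₗ N k) ∘ₗ (LinearMap.id + ((mulOp (fun p : X × ι => ψX k p.1) ∘ₗ (unstackM (tCoefC η (gaugePair τ fun μ x => coordMat e (ContinuousLinearMap.mulLeftRight ℝ (Matrix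 m m ℂ) (u k x * U μ x * (u k (τ μ x))ᴴ) (u k x * U μ x * (u k (τ μ x))ᴴ)ᴴ))) (tCoefA η (gaugePair τ fun μ x => coordMat e (ContinuousLinearMap.mulLeftRight ℝ (Matrix m m ℂ) (u k x * U μ x * (u k (τ μ x))ᴴ) (u k x * U μ x * (u k (τ μ x))ᴴ)ᴴ))) + NV k ∘ₗ projO none) ∘ₗ mulOp (fun q : (X × ι) × Option (J ⊕ J) => χX k q.1.1)) ∘ₗ stack LinearMap.id (fun j => Sum.elim (fun μ => fgrad η⁻¹ (liftEquiv (τ μ) ι)) (fun μ => bgrad η⁻¹ (liftEquiv (τ μ) ι)) j)) ∘ₗ (projO none ∘ₗ bgPropV (stack (mulOp (fun p : X × ι => χtX k p.1) ∘ₗ N k) (fun j => Sum.elim (fun μ => fgrad η⁻¹ (liftEquiv (τ μ) ι)) (fun μ => bgrad η⁻¹ (liftEquiv (τ μ) ι)) j ∘ₗ (mulOp (fun p : X × ι => χtX k p.1) ∘ₗ N k))) (mulOp (fun p : X × ι => ψX k p.1) ∘ₗ (unstackM (tCoefC η (gaugePair τ fun μ x => coordMat e (ContinuousLinearMap.mulLeftRight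 ℝ (Matrix m m ℂ) (u k x * U μ x * (u k (τ μ x))ᴴ) (u k x * U μ x * (u k (τ μ x))ᴴ)ᴴ))) (tCoefA η (gaugePair τ fun μ x => coordMat e (ContinuousLinearMap.mulLeftRight ℝ (Matrix m m ℂ) (u k x * U μ x * (u k (τ μ x))ᴴ) (u k x * U μ x * (u k (τ μ x))ᴴ)ᴴ))) + NV k ∘ₗ projO none) ∘ₗ mulOp (fun q : (X × ι) × Option (J ⊕ J) => χX k q.1.1)))) + mulOp (fun p : X × ι => hX k p.1) ∘ₗ (-(((unstackM (tCoefC η (gaugePair τ fun μ x => coordMat e (ContinuousLinearMap.mulLeftRight ℝ (Matrix m m ℂ) (u k x * U μ x * (u k (τ μ x))ᴴ) (u k x * U μ x * (u k (τ μ x))ᴴ)ᴴ))) (tCoefA η (gaugePair τ fun μ x => coordMat e (ContinuousLinearMap.mulLeftRight ℝ (Matrix m m ℂ) (u k x * U μ x * (u k (τ μ x))ᴴ) (u k x * U μ x * (u k (τ μ x))ᴴ)ᴴ))) + NV k ∘ₗ projO none) - mulOp (fun p : X × ι => ψX k p.1) ∘ₗ (unstackM (tCoefC η (gaugePair τ fun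 μ x => coordMat e (ContinuousLinearMap.mulLeftRight ℝ (Matrix m m ℂ) (u k x * U μ x * (u k (τ μ x))ᴴ) (u k x * U μ x * (u k (τ μ x))ᴴ)ᴴ))) (tCoefA η (gaugePair τ fun μ x => coordMat e (ContinuousLinearMap.mulLeftRight ℝ (Matrix m m ℂ) (u k x * U μ x * (u k (τ μ x))ᴴ) (u k x * U μ x * (u k (τ μ x))ᴴ)ᴴ))) + NV k ∘ₗ projO none) ∘ₗ mulOp (fun q : (X × ι) × Option (J ⊕ J) => χX k q.1.1)) ∘ₗ stack LinearMap.id (fun j => Sum.elim (fun μ => fgrad η⁻¹ (liftEquiv (τ μ) ι)) (fun μ => bgrad η⁻¹ (liftEquiv (τ μ) ι)) j))) ∘ₗ (projO none ∘ₗ bgPropV (stack (mulOp (fun p : X × ι => χtX k p.1) ∘ₗ N k) (fun j => Sum.elim (fun μ => fgrad η⁻¹ (liftEquiv (τ μ) ι)) (fun μ => bgrad η⁻¹ (liftEquiv (τ μ) ι)) j ∘ₗ (mulOp (fun p : X × ι => χtX k p.1) ∘ₗ N k))) (mulOp (fun p : X × ι => ψX k p.1) ∘ₗ (unstackM (tCoefC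 η (gaugePair τ fun μ x => coordMat e (ContinuousLinearMap.mulLeftRight ℝ (Matrix m m ℂ) (u k x * U μ x * (u k (τ μ x))ᴴ) (u k x * U μ x * (u k (τ μ x))ᴴ)ᴴ))) (tCoefA η (gaugePair τ fun μ x => coordMat e (ContinuousLinearMap.mulLeftRight ℝ (Matrix m m ℂ) (u k x * U μ x * (u k (τ μ x))ᴴ) (u k x * U μ x * (u k (τ μ x))ᴴ)ᴴ))) + NV k ∘ₗ projO none) ∘ₗ mulOp (fun q : (X × ι) × Option (J ⊕ J) => χX k q.1.1))))) ∘ₗ mmulOp (fun x => coordMat e (ContinuousLinearMap.mulLeftRight ℝ (Matrix m m ℂ) (u k x) (u k x)ᴴ))) ∘ₗ mulOp (fun p : X × ι => hX k p.1)) -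
        Dg₂ ∘ₗ glueInv (parametrix (fun k (p : X × ι) => hX k p.1) (fun k => mmulOp (fun x => (coordMat e (ContinuousLinearMap.mulLeftRight ℝ (Matrix m m ℂ) (u₂ k x) (u₂ k x)ᴴ))ᵀ) ∘ₗ (projO none ∘ₗ bgPropV (stack (mulOp (fun p : X × ι => χtX k p.1) ∘ₗ N k) (fun j => Sum.elim (fun μ => fgrad η⁻¹ (liftEquiv (τ μ) ι)) (fun μ => bgrad η⁻¹ (liftEquiv (τ μ) ι)) j ∘ₗ (mulOp (fun p : X × ι => χtX k p.1) ∘ₗ N k))) (mulOp (fun p : X × ι => ψX k p.1) ∘ₗ (unstackM (tCoefC η (gaugePair τ fun μ x => coordMat e (ContinuousLinearMap.mulLeftRight ℝ (Matrix m m ℂ) (u₂ k x * U₂ μ x * (u₂ k (τ μ x))ᴴ) (u₂ k x * U₂ μ x * (u₂ k (τ μ x))ᴴ)ᴴ))) (tCoefA η (gaugePair τ fun μ x => coordMat e (ContinuousLinearMap.mulLeftRight ℝ (Matrix m m ℂ) (u₂ k x * U₂ μ x * (u₂ k (τ μ x))ᴴ) (u₂ k x * U₂ μ x * (u₂ k (τ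 μ x))ᴴ)ᴴ))) + NV₂ k ∘ₗ projO none) ∘ₗ mulOp (fun q : (X × ι) × Option (J ⊕ J) => χX k q.1.1))) ∘ₗ mmulOp (fun x => coordMat e (ContinuousLinearMap.mulLeftRight ℝ (Matrix m m ℂ) (u₂ k x) (u₂ k x)ᴴ)))) (remainder (covLapM τ η (gaugePair τ (fun μ x => coordMat e (ContinuousLinearMap.mulLeftRight ℝ (Matrix m m ℂ) (U₂ μ x) (U₂ μ x)ᴴ))) + P₂) (fun k (p : X × ι) => hX k p.1) (fun k => mmulOp (fun x => (coordMat e (ContinuousLinearMap.mulLeftRight ℝ (Matrix m m ℂ) (u₂ k x) (u₂ k x)ᴴ))ᵀ) ∘ₗ (projO none ∘ₗ bgPropV (stack (mulOp (fun p : X × ι => χtX k p.1) ∘ₗ N k) (fun j => Sum.elim (fun μ => fgrad η⁻¹ (liftEquiv (τ μ) ι)) (fun μ => bgrad η⁻¹ (liftEquiv (τ μ) ι)) j ∘ₗ (mulOp (fun p : X × ι => χtX k p.1) ∘ₗ N k))) (mulOp (fun p : X × ι => ψX k p.1) ∘ₗ (unstackM (tCoefC η (gaugePair τ fun μ x =>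 coordMat e (ContinuousLinearMap.mulLeftRight ℝ (Matrix m m ℂ) (u₂ k x * U₂ μ x * (u₂ k (τ μ x))ᴴ) (u₂ k x * U₂ μ x * (u₂ k (τ μ x))ᴴ)ᴴ))) (tCoefA η (gaugePair τ fun μ x => coordMat e (ContinuousLinearMap.mulLeftRight ℝ (Matrix m m ℂ) (u₂ k x * U₂ μ x * (u₂ k (τ μ x))ᴴ) (u₂ k x * U₂ μ x * (u₂ k (τ μ x))ᴴ)ᴴ))) + NV₂ k ∘ₗ projO none) ∘ₗ mulOp (fun q : (X × ι) × Option (J ⊕ J) => χX k q.1.1))) ∘ₗ mmulOp (fun x => coordMat e (ContinuousLinearMap.mulLeftRight ℝ (Matrix m m ℂ) (u₂ k x) (u₂ k x)ᴴ))) - ∑ k, (mmulOp (fun x => (coordMat e (ContinuousLinearMap.mulLeftRight ℝ (Matrix m m ℂ) (u₂ k x) (u₂ k x)ᴴ))ᵀ) ∘ₗ ((((-(mulOp (fun p : X × ι => hX k p.1) ∘ₗ NL ∘ₗ mulOp (1 - fun p : X × ι => χtX k p.1))) ∘ₗ N k) ∘ₗ (LinearMap.id + ((mulOp (fun p : X ×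 ι => ψX k p.1) ∘ₗ (unstackM (tCoefC η (gaugePair τ fun μ x => coordMat e (ContinuousLinearMap.mulLeftRight ℝ (Matrix m m ℂ) (u₂ k x * U₂ μ x * (u₂ k (τ μ x))ᴴ) (u₂ k x * U₂ μ x * (u₂ k (τ μ x))ᴴ)ᴴ))) (tCoefA η (gaugePair τ fun μ x => coordMat e (ContinuousLinearMap.mulLeftRight ℝ (Matrix m m ℂ) (u₂ k x * U₂ μ x * (u₂ k (τ μ x))ᴴ) (u₂ k x * U₂ μ x * (u₂ k (τ μ x))ᴴ)ᴴ))) + NV₂ k ∘ₗ projO none) ∘ₗ mulOp (fun q : (X × ι) × Option (J ⊕ J) => χX k q.1.1)) ∘ₗ stack LinearMap.id (fun j => Sum.elim (fun μ => fgrad η⁻¹ (liftEquiv (τ μ) ι)) (fun μ => bgrad η⁻¹ (liftEquiv (τ μ) ι)) j)) ∘ₗ (projO none ∘ₗ bgPropV (stack (mulOp (fun p : X × ι => χtX k p.1) ∘ₗ N k) (fun j => Sum.elim (fun μ => fgrad η⁻¹ (liftEquiv (τ μ) ι)) (fun μ => bgrad η⁻¹ (liftEquiv (τ μ) ι)) j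 ∘ₗ (mulOp (fun p : X × ι => χtX k p.1) ∘ₗ N k))) (mulOp (fun p : X × ι => ψX k p.1) ∘ₗ (unstackM (tCoefC η (gaugePair τ fun μ x => coordMat e (ContinuousLinearMap.mulLeftRight ℝ (Matrix m m ℂ) (u₂ k x * U₂ μ x * (u₂ k (τ μ x))ᴴ) (u₂ k x * U₂ μ x * (u₂ k (τ μ x))ᴴ)ᴴ))) (tCoefA η (gaugePair τ fun μ x => coordMat e (ContinuousLinearMap.mulLeftRight ℝ (Matrix m m ℂ) (u₂ k x * U₂ μ x * (u₂ k (τ μ x))ᴴ) (u₂ k x * U₂ μ x * (u₂ k (τ μ x))ᴴ)ᴴ))) + NV₂ k ∘ₗ projO none) ∘ₗ mulOp (fun q : (X × ι) × Option (J ⊕ J) => χX k q.1.1)))) + mulOp (fun p : X × ι => hX k p.1) ∘ₗ (-(((unstackM (tCoefC η (gaugePair τ fun μ x => coordMat e (ContinuousLinearMap.mulLeftRight ℝ (Matrix m m ℂ) (u₂ k x * U₂ μ x * (u₂ k (τ μ x))ᴴ) (u₂ k x * U₂ μ x * (u₂ k (τ μ x))ᴴ)ᴴ))) (tCoefA η (gaugePair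 τ fun μ x => coordMat e (ContinuousLinearMap.mulLeftRight ℝ (Matrix m m ℂ) (u₂ k x * U₂ μ x * (u₂ k (τ μ x))ᴴ) (u₂ k x * U₂ μ x * (u₂ k (τ μ x))ᴴ)ᴴ))) + NV₂ k ∘ₗ projO none) - mulOp (fun p : X × ι => ψX k p.1) ∘ₗ (unstackM (tCoefC η (gaugePair τ fun μ x => coordMat e (ContinuousLinearMap.mulLeftRight ℝ (Matrix m m ℂ) (u₂ k x * U₂ μ x * (u₂ k (τ μ x))ᴴ) (u₂ k x * U₂ μ x * (u₂ k (τ μ x))ᴴ)ᴴ))) (tCoefA η (gaugePair τ fun μ x => coordMat e (ContinuousLinearMap.mulLeftRight ℝ (Matrix m m ℂ) (u₂ k x * U₂ μ x * (u₂ k (τ μ x))ᴴ) (u₂ k x * U₂ μ x * (u₂ k (τ μ x))ᴴ)ᴴ))) + NV₂ k ∘ₗ projO none) ∘ₗ mulOp (fun q : (X × ι) × Option (J ⊕ J) => χX k q.1.1)) ∘ₗ stack LinearMap.id (fun j => Sum.elim (fun μ => fgrad η⁻¹ (liftEquiv (τ μ) ι)) (fun μ => bgrad η⁻¹ (liftEquiv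 (τ μ) ι)) j))) ∘ₗ (projO none ∘ₗ bgPropV (stack (mulOp (fun p : X × ι => χtX k p.1) ∘ₗ N k) (fun j => Sum.elim (fun μ => fgrad η⁻¹ (liftEquiv (τ μ) ι)) (fun μ => bgrad η⁻¹ (liftEquiv (τ μ) ι)) j ∘ₗ (mulOp (fun p : X × ι => χtX k p.1) ∘ₗ N k))) (mulOp (fun p : X × ι => ψX k p.1) ∘ₗ (unstackM (tCoefC η (gaugePair τ fun μ x => coordMat e (ContinuousLinearMap.mulLeftRight ℝ (Matrix m m ℂ) (u₂ k x * U₂ μ x * (u₂ k (τ μ x))ᴴ) (u₂ k x * U₂ μ x * (u₂ k (τ μ x))ᴴ)ᴴ))) (tCoefA η (gaugePair τ fun μ x => coordMat e (ContinuousLinearMap.mulLeftRight ℝ (Matrix m m ℂ) (u₂ k x * U₂ μ x * (u₂ k (τ μ x))ᴴ) (u₂ k x * U₂ μ x * (u₂ k (τ μ x))ᴴ)ᴴ))) + NV₂ k ∘ₗ projO none) ∘ₗ mulOp (fun q : (X × ι) × Option (J ⊕ J) => χX k q.1.1))))) ∘ₗ mmulOp (fun x => coordMat e (ContinuousLinearMap.mulLeftRight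 ℝ (Matrix m m ℂ) (u₂ k x) (u₂ k x)ᴴ))) ∘ₗ mulOp (fun p : X × ι => hX k p.1)))
      (fun y y' => ((Nov * (cs * ((Fintype.card ι : ℝ) ^ 2 * ((2 * ((β + (β₁ + ct * β)) * ((rV * (1 + Fintype.card (J ⊕ J)) + RN) * ((β + (β₁ + ct * β)) * (1 - (β + (β₁ + ct * β)) * (R * cr) * cr)⁻¹) * cr) * cr)) + 2 * (rP * ((β + (β₁ + ct * β)) * (1 - (β + (β₁ + ct * β)) * (R * cr) * cr)⁻¹) * cr))) + cd * ((Fintype.card ι : ℝ) ^ 2 * (2 * ((β + (β₁ + ct * β)) * ((rV * (1 + Fintype.card (J ⊕ J)) + RN) * ((β + (β₁ + ct * β)) * (1 - (β + (β₁ + ct * β)) * (R * cr) * cr)⁻¹) * cr) * cr)))) +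
            Nov * (cs * ((Fintype.card ι : ℝ) ^ 2 * (((β + (β₁ + ct * β)) * (1 - (β + (β₁ + ct * β)) * (R * cr) * cr)⁻¹) + rP * ((β + (β₁ + ct * β)) * (1 - (β + (β₁ + ct * β)) * (R * cr) * cr)⁻¹) * cr)) + cd * ((Fintype.card ι : ℝ) ^ 2 * ((β + (β₁ + ct * β)) * (1 - (β + (β₁ + ct * β)) * (R * cr) * cr)⁻¹))) * ((1 - Nov * ((Fintype.card ι : ℝ) ^ 2 * ((((Fintype.card J : ℝ) * (c₂ * ((β + (β₁ + ct * β)) * (1 - (β + (β₁ + ct * β)) * (R * cr) * cr)⁻¹) + 2 * (c₁ * ((β + (β₁ + ct * β)) * (1 - (β + (β₁ + ct * β)) * (R * cr) * cr)⁻¹))) + θW + cN * ((β + (β₁ + ct * β)) * (1 - (β + (β₁ + ct * β)) * (R * cr) * cr)⁻¹) * cr) + ((ℓ * (Real.exp 1 * ε)⁻¹ + 2 * (ω + ℓ * d₁)) * R * ((β + (β₁ + ct * β)) * (1 - (β + (β₁ + ct * β)) * (R * cr) * cr)⁻¹) * cr + R * c₁ * ((β + (β₁ + ct * β)) * (1 -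 (β + (β₁ + ct * β)) * (R * cr) * cr)⁻¹) * cr)) + (θF * (1 * ((β + (β₁ + ct * β)) * (1 - (β + (β₁ + ct * β)) * (R * cr) * cr)⁻¹)) * cr)) + (Fintype.card ι : ℝ) ^ 2 * ((ε₀ * (1 - (β + (β₁ + ct * β)) * (R * cr) * cr)⁻¹) + 0)) * cr)⁻¹ * cr) *
              (Nov * ((Fintype.card ι : ℝ) ^ 2 * (2 * ((((Fintype.card J : ℝ) * (c₂ * ((β + (β₁ + ct * β)) * (1 - (β + (β₁ + ct * β)) * (R * cr) * cr)⁻¹) + 2 * (c₁ * ((β + (β₁ + ct * β)) * (1 - (β + (β₁ + ct * β)) * (R * cr) * cr)⁻¹))) + θW + cN * ((β + (β₁ + ct * β)) * (1 - (β + (β₁ + ct * β)) * (R * cr) * cr)⁻¹) * cr) + ((ℓ * (Real.exp 1 * ε)⁻¹ + 2 * (ω + ℓ * d₁)) * R * ((β + (β₁ + ct * β)) * (1 - (β + (β₁ + ct * β)) * (R * cr) * cr)⁻¹) * cr + R * c₁ * ((β + (β₁ + ct * β)) * (1 - (β + (β₁ + ct * β)) * (R * cr) * cr)⁻¹) * cr))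 + (θF * (1 * ((β + (β₁ + ct * β)) * (1 - (β + (β₁ + ct * β)) * (R * cr) * cr)⁻¹)) * cr))) + (Fintype.card ι : ℝ) ^ 2 * (2 * ((ε₀ * (1 - (β + (β₁ + ct * β)) * (R * cr) * cr)⁻¹) + 0)))) * cr) * ((1 - Nov * ((Fintype.card ι : ℝ) ^ 2 * ((((Fintype.card J : ℝ) * (c₂ * ((β + (β₁ + ct * β)) * (1 - (β + (β₁ + ct * β)) * (R * cr) * cr)⁻¹) + 2 * (c₁ * ((β + (β₁ + ct * β)) * (1 - (β + (β₁ + ct * β)) * (R * cr) * cr)⁻¹))) + θW + cN * ((β + (β₁ + ct * β)) * (1 - (β + (β₁ + ct * β)) * (R * cr) * cr)⁻¹) * cr) + ((ℓ * (Real.exp 1 * ε)⁻¹ + 2 * (ω + ℓ * d₁)) * R * ((β + (β₁ + ct * β)) * (1 - (β + (β₁ + ct * β)) * (R * cr) * cr)⁻¹) * cr + R * c₁ * ((β + (β₁ + ct * β)) * (1 - (β + (β₁ + ct * β)) * (R * cr) * cr)⁻¹) * cr)) + (θF * (1 * ((β + (β₁ + ct * β)) * (1 - (β + (β₁ + ct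 * β)) * (R * cr) * cr)⁻¹)) * cr)) + (Fintype.card ι : ℝ) ^ 2 * ((ε₀ * (1 - (β + (β₁ + ct * β)) * (R * cr) * cr)⁻¹) + 0)) * cr)⁻¹ * cr) +
          (Nov * (cs * (2 * ((Fintype.card ι : ℝ) ^ 2 * (((β + (β₁ + ct * β)) * (1 - (β + (β₁ + ct * β)) * (R * cr) * cr)⁻¹) + rP * ((β + (β₁ + ct * β)) * (1 - (β + (β₁ + ct * β)) * (R * cr) * cr)⁻¹) * cr))) + cd * (2 * ((Fintype.card ι : ℝ) ^ 2 * ((β + (β₁ + ct * β)) * (1 - (β + (β₁ + ct * β)) * (R * cr) * cr)⁻¹)))) +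
            Nov * (cs * ((Fintype.card ι : ℝ) ^ 2 * (((β + (β₁ + ct * β)) * (1 - (β + (β₁ + ct * β)) * (R * cr) * cr)⁻¹) + rP * ((β + (β₁ + ct * β)) * (1 - (β + (β₁ + ct * β)) * (R * cr) * cr)⁻¹) * cr)) + cd * ((Fintype.card ι : ℝ) ^ 2 * ((β + (β₁ + ct * β)) * (1 - (β + (β₁ + ct * β)) * (R * cr) * cr)⁻¹))) * ((1 - Nov * ((Fintype.card ι : ℝ) ^ 2 * ((((Fintype.card J : ℝ) * (c₂ * ((β + (β₁ + ct * β)) * (1 - (β + (β₁ + ct * β)) * (R * cr) * cr)⁻¹) + 2 * (c₁ * ((β + (β₁ + ct * β)) * (1 - (β + (β₁ + ct * β)) * (R * cr) * cr)⁻¹))) + θW + cN * ((β + (β₁ + ct * β)) * (1 - (β + (β₁ + ct * β)) * (R * cr) * cr)⁻¹) * cr) + ((ℓ * (Real.exp 1 * ε)⁻¹ + 2 * (ω + ℓ * d₁)) * R * ((β + (β₁ + ct * β)) * (1 - (β + (β₁ + ct * β)) * (R * cr) * cr)⁻¹) * cr + R * c₁ * ((β + (β₁ + ct * β)) * (1 -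 (β + (β₁ + ct * β)) * (R * cr) * cr)⁻¹) * cr)) + (θF * (1 * ((β + (β₁ + ct * β)) * (1 - (β + (β₁ + ct * β)) * (R * cr) * cr)⁻¹)) * cr)) + (Fintype.card ι : ℝ) ^ 2 * ((ε₀ * (1 - (β + (β₁ + ct * β)) * (R * cr) * cr)⁻¹) + 0)) * cr)⁻¹ * cr) *
              (Nov * (2 * ((Fintype.card ι : ℝ) ^ 2 * ((ε₀ * (1 - (β + (β₁ + ct * β)) * (R * cr) * cr)⁻¹) + 0))) + Nov * (2 * ((Fintype.card ι : ℝ) ^ 2 * ((((Fintype.card J : ℝ) * (c₂ * ((β + (β₁ + ct * β)) * (1 - (β + (β₁ + ct * β)) * (R * cr) * cr)⁻¹) + 2 * (c₁ * ((β + (β₁ + ct * β)) * (1 - (β + (β₁ + ct * β)) * (R * cr) * cr)⁻¹))) + θW + cN * ((β + (β₁ + ct * β)) * (1 - (β + (β₁ + ct * β)) * (R * cr) * cr)⁻¹) * cr) + ((ℓ * (Real.exp 1 * ε)⁻¹ + 2 * (ω + ℓ * d₁)) * R * ((β + (β₁ + ct * β)) * (1 - (β + (β₁ + ct * β)) * (R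 * cr) * cr)⁻¹) * cr + R * c₁ * ((β + (β₁ + ct * β)) * (1 - (β + (β₁ + ct * β)) * (R * cr) * cr)⁻¹) * cr)) + (θF * (1 * ((β + (β₁ + ct * β)) * (1 - (β + (β₁ + ct * β)) * (R * cr) * cr)⁻¹)) * cr))))) * cr) *
            ((1 - Nov * ((Fintype.card ι : ℝ) ^ 2 * ((((Fintype.card J : ℝ) * (c₂ * ((β + (β₁ + ct * β)) * (1 - (β + (β₁ + ct * β)) * (R * cr) * cr)⁻¹) + 2 * (c₁ * ((β + (β₁ + ct * β)) * (1 - (β + (β₁ + ct * β)) * (R * cr) * cr)⁻¹))) + θW + cN * ((β + (β₁ + ct * β)) * (1 - (β + (β₁ + ct * β)) * (R * cr) * cr)⁻¹) * cr) + ((ℓ * (Real.exp 1 * ε)⁻¹ + 2 * (ω + ℓ * d₁)) * R * ((β + (β₁ + ct * β)) * (1 - (β + (β₁ + ct * β)) * (R * cr) * cr)⁻¹) * cr + R * c₁ * ((β + (β₁ + ct * β)) * (1 - (β + (β₁ + ct * β)) * (R * cr) * cr)⁻¹) * cr)) + (θF * (1 * ((β + (β₁ + ct * β)) * (1 - (β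 + (β₁ + ct * β)) * (R * cr) * cr)⁻¹)) * cr)) + (Fintype.card ι : ℝ) ^ 2 * ((ε₀ * (1 - (β + (β₁ + ct * β)) * (R * cr) * cr)⁻¹) + 0)) * cr)⁻¹ * cr) * Real.exp (-((ρ₃ / 4 - σ) * dZ y))) *
        Real.exp (-((ρ₃ / 4 - 2 * σ) * g.dist y y'))) := by
  have hβb : 0 ≤ β + (β₁ + ct * β) := by positivity
  have hqi : 0 ≤ (1 - (β + (β₁ + ct * β)) * (R * cr) * cr)⁻¹ := inv_nonneg.2 (by linarith)
  have hB : 0 ≤ ((β + (β₁ + ct * β)) * (1 - (β + (β₁ + ct * β)) * (R * cr) * cr)⁻¹) := mul_nonneg hβb hqi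
  have hug : ∀ k x, coordMat e (ContinuousLinearMap.mulLeftRight ℝ (Matrix m m ℂ) (u k x) (u k x)ᴴ) * (coordMat e (ContinuousLinearMap.mulLeftRight ℝ (Matrix m m ℂ) (u k x) (u k x)ᴴ))ᵀ = 1 := fun k x => (uN_siteGauge_orthogonal e (u k) he (hu k) x).1
  have hug₂ : ∀ k x, coordMat e (ContinuousLinearMap.mulLeftRight ℝ (Matrix m m ℂ) (u₂ k x) (u₂ k x)ᴴ) * (coordMat e (ContinuousLinearMap.mulLeftRight ℝ (Matrix m m ℂ) (u₂ k x) (u₂ k x)ᴴ))ᵀ = 1 := fun k x => (uN_siteGauge_orthogonal e (u₂ k) he (hu₂ k) x).1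
  have hug' : ∀ k x, (coordMat e (ContinuousLinearMap.mulLeftRight ℝ (Matrix m m ℂ) (u k x) (u k x)ᴴ))ᵀ * coordMat e (ContinuousLinearMap.mulLeftRight ℝ (Matrix m m ℂ) (u k x) (u k x)ᴴ) = 1 := fun k x => (uN_siteGauge_orthogonal e (u k) he (hu k) x).2
  have hug₂' : ∀ k x, (coordMat e (ContinuousLinearMap.mulLeftRight ℝ (Matrix m m ℂ) (u₂ k x) (u₂ k x)ᴴ))ᵀ * coordMat e (ContinuousLinearMap.mulLeftRight ℝ (Matrix m m ℂ) (u₂ k x) (u₂ k x)ᴴ) = 1 := fun k x => (uN_siteGauge_orthogonal e (u₂ k) he (hu₂ k) x).2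
  have hcov : ∀ k, mmulOp (fun x => coordMat e (ContinuousLinearMap.mulLeftRight ℝ (Matrix m m ℂ) (u k x) (u k x)ᴴ)) ∘ₗ (covLapM τ η (gaugePair τ (fun μ x => coordMat e (ContinuousLinearMap.mulLeftRight ℝ (Matrix m m ℂ) (U μ x) (U μ x)ᴴ))) + P) ∘ₗ mmulOp (fun x => (coordMat e (ContinuousLinearMap.mulLeftRight ℝ (Matrix m m ℂ) (u k x) (u k x)ᴴ))ᵀ) =
      (lapOp η⁻¹ (fun μ => liftEquiv (τ μ) ι) 0 + NL - (mulOp (fun p : X × ι => ψX k p.1) ∘ₗ (unstackM (tCoefC η (gaugePair τ fun μ x => coordMat e (ContinuousLinearMap.mulLeftRight ℝ (Matrix m m ℂ) (u k x * U μ x * (u k (τ μ x))ᴴ) (u k x * U μ x * (u k (τ μ x))ᴴ)ᴴ)))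
            (tCoefA η (gaugePair τ fun μ x => coordMat e (ContinuousLinearMap.mulLeftRight ℝ (Matrix m m ℂ) (u k x * U μ x * (u k (τ μ x))ᴴ) (u k x * U μ x * (u k (τ μ x))ᴴ)ᴴ))) + NV k ∘ₗ projO none) ∘ₗ mulOp (fun q : (X × ι) × Option (J ⊕ J) => χX k q.1.1)) ∘ₗ stack LinearMap.id (fun j => Sum.elim (fun μ => fgrad η⁻¹ (liftEquiv (τ μ) ι)) (fun μ => bgrad η⁻¹ (liftEquiv (τ μ) ι)) j)) + (-(((unstackM (tCoefC η (gaugePair τ fun μ x => coordMat e (ContinuousLinearMap.mulLeftRight ℝ (Matrix m m ℂ) (u k x * U μ x * (u k (τ μ x))ᴴ) (u k x * U μ x * (u k (τ μ x))ᴴ)ᴴ)))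
            (tCoefA η (gaugePair τ fun μ x => coordMat e (ContinuousLinearMap.mulLeftRight ℝ (Matrix m m ℂ) (u k x * U μ x * (u k (τ μ x))ᴴ) (u k x * U μ x * (u k (τ μ x))ᴴ)ᴴ))) + NV k ∘ₗ projO none) - mulOp (fun p : X × ι => ψX k p.1) ∘ₗ (unstackM (tCoefC η (gaugePair τ fun μ x => coordMat e (ContinuousLinearMap.mulLeftRight ℝ (Matrix m m ℂ) (u k x * U μ x * (u k (τ μ x))ᴴ) (u k x * U μ x * (u k (τ μ x))ᴴ)ᴴ)))
            (tCoefA η (gaugePair τ fun μ x => coordMat e (ContinuousLinearMap.mulLeftRight ℝ (Matrix m m ℂ) (u k x * U μ x * (u k (τ μ x))ᴴ) (u k x * U μ x * (u k (τ μ x))ᴴ)ᴴ))) + NV k ∘ₗ projO none) ∘ₗ mulOp (fun q : (X × ι) × Option (J ⊕ J) => χX k q.1.1)) ∘ₗ stack LinearMap.id (fun j => Sum.elim (fun μ => fgrad η⁻¹ (liftEquiv (τ μ) ι)) (fun μ => bgrad η⁻¹ (liftEquiv (τ μ) ι)) j))) := fun k => by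
    rw [uN_localOp_species_form e τ (u k) U η he (hu k) P, hP k, ← localOp_eq_cut_add_farDefect, LinearMap.add_comp, LinearMap.comp_assoc, projO_none_comp_stack, LinearMap.comp_id]
    abel
  have hcov₂ : ∀ k, mmulOp (fun x => coordMat e (ContinuousLinearMap.mulLeftRight ℝ (Matrix m m ℂ) (u₂ k x) (u₂ k x)ᴴ)) ∘ₗ (covLapM τ η (gaugePair τ (fun μ x => coordMat e (ContinuousLinearMap.mulLeftRight ℝ (Matrix m m ℂ) (U₂ μ x) (U₂ μ x)ᴴ))) + P₂) ∘ₗ mmulOp (fun x => (coordMat e (ContinuousLinearMap.mulLeftRight ℝ (Matrix m m ℂ) (u₂ k x) (u₂ k x)ᴴ))ᵀ) =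
      (lapOp η⁻¹ (fun μ => liftEquiv (τ μ) ι) 0 + NL - (mulOp (fun p : X × ι => ψX k p.1) ∘ₗ (unstackM (tCoefC η (gaugePair τ fun μ x => coordMat e (ContinuousLinearMap.mulLeftRight ℝ (Matrix m m ℂ) (u₂ k x * U₂ μ x * (u₂ k (τ μ x))ᴴ) (u₂ k x * U₂ μ x * (u₂ k (τ μ x))ᴴ)ᴴ)))
            (tCoefA η (gaugePair τ fun μ x => coordMat e (ContinuousLinearMap.mulLeftRight ℝ (Matrix m m ℂ) (u₂ k x * U₂ μ x * (u₂ k (τ μ x))ᴴ) (u₂ k x * U₂ μ x * (u₂ k (τ μ x))ᴴ)ᴴ))) + NV₂ k ∘ₗ projO none) ∘ₗ mulOp (fun q : (X × ι) × Option (J ⊕ J) => χX k q.1.1)) ∘ₗ stack LinearMap.id (fun j => Sum.elim (fun μ => fgrad η⁻¹ (liftEquiv (τ μ) ι)) (fun μ => bgrad η⁻¹ (liftEquiv (τ μ) ι)) j)) + (-(((unstackM (tCoefC η (gaugePair τ fun μ x => coordMat e (ContinuousLinearMap.mulLeftRight ℝ (Matrix m m ℂ) (u₂ k x * U₂ μ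 x * (u₂ k (τ μ x))ᴴ) (u₂ k x * U₂ μ x * (u₂ k (τ μ x))ᴴ)ᴴ)))
            (tCoefA η (gaugePair τ fun μ x => coordMat e (ContinuousLinearMap.mulLeftRight ℝ (Matrix m m ℂ) (u₂ k x * U₂ μ x * (u₂ k (τ μ x))ᴴ) (u₂ k x * U₂ μ x * (u₂ k (τ μ x))ᴴ)ᴴ))) + NV₂ k ∘ₗ projO none) - mulOp (fun p : X × ι => ψX k p.1) ∘ₗ (unstackM (tCoefC η (gaugePair τ fun μ x => coordMat e (ContinuousLinearMap.mulLeftRight ℝ (Matrix m m ℂ) (u₂ k x * U₂ μ x * (u₂ k (τ μ x))ᴴ) (u₂ k x * U₂ μ x * (u₂ k (τ μ x))ᴴ)ᴴ)))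
            (tCoefA η (gaugePair τ fun μ x => coordMat e (ContinuousLinearMap.mulLeftRight ℝ (Matrix m m ℂ) (u₂ k x * U₂ μ x * (u₂ k (τ μ x))ᴴ) (u₂ k x * U₂ μ x * (u₂ k (τ μ x))ᴴ)ᴴ))) + NV₂ k ∘ₗ projO none) ∘ₗ mulOp (fun q : (X × ι) × Option (J ⊕ J) => χX k q.1.1)) ∘ₗ stack LinearMap.id (fun j => Sum.elim (fun μ => fgrad η⁻¹ (liftEquiv (τ μ) ι)) (fun μ => bgrad η⁻¹ (liftEquiv (τ μ) ι)) j))) := fun k => by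
    rw [uN_localOp_species_form e τ (u₂ k) U₂ η he (hu₂ k) P₂, hP₂ k, ← localOp_eq_cut_add_farDefect, LinearMap.add_comp, LinearMap.comp_assoc, projO_none_comp_stack, LinearMap.comp_id]
    abel
  have hV : ∀ k, HasMaj (BlockNorm.ofBlocks g (blkPair (liftBlk blk ι))) (BlockNorm.ofBlocks g (liftBlk blk ι)) (mulOp (fun p : X × ι => ψX k p.1) ∘ₗ (unstackM (tCoefC η (gaugePair τ fun μ x => coordMat e (ContinuousLinearMap.mulLeftRight ℝ (Matrix m m ℂ) (u k x * U μ x * (u k (τ μ x))ᴴ) (u k x * U μ x * (u k (τ μ x))ᴴ)ᴴ)))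
            (tCoefA η (gaugePair τ fun μ x => coordMat e (ContinuousLinearMap.mulLeftRight ℝ (Matrix m m ℂ) (u k x * U μ x * (u k (τ μ x))ᴴ) (u k x * U μ x * (u k (τ μ x))ᴴ)ᴴ))) + NV k ∘ₗ projO none) ∘ₗ mulOp (fun q : (X × ι) × Option (J ⊕ J) => χX k q.1.1)) (fun y y' => R * Real.exp (-(δV * g.dist y y'))) := fun k =>
    (hasMaj_cutPert_structural_of_local blk hd0 hrV hRN (hχ1 k) (hCloc k) (fun μ x hx => hAloc k μ x hx) (hψχ k) (hNVcut k)).mono fun y y' =>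
      mul_le_mul_of_nonneg_right hRle (Real.exp_nonneg _)
  have hV₂ : ∀ k, HasMaj (BlockNorm.ofBlocks g (blkPair (liftBlk blk ι))) (BlockNorm.ofBlocks g (liftBlk blk ι)) (mulOp (fun p : X × ι => ψX k p.1) ∘ₗ (unstackM (tCoefC η (gaugePair τ fun μ x => coordMat e (ContinuousLinearMap.mulLeftRight ℝ (Matrix m m ℂ) (u₂ k x * U₂ μ x * (u₂ k (τ μ x))ᴴ) (u₂ k x * U₂ μ x * (u₂ k (τ μ x))ᴴ)ᴴ)))
            (tCoefA η (gaugePair τ fun μ x => coordMat e (ContinuousLinearMap.mulLeftRight ℝ (Matrix m m ℂ) (u₂ k x * U₂ μ x * (u₂ k (τ μ x))ᴴ) (u₂ k x * U₂ μ x * (u₂ k (τ μ x))ᴴ)ᴴ))) + NV₂ k ∘ₗ projO none) ∘ₗ mulOp (fun q : (X × ι) × Option (J ⊕ J) => χX k q.1.1)) (fun y y' => R * Real.exp (-(δV * g.dist y y'))) := fun k =>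
    (hasMaj_cutPert_structural_of_local blk hd0 hrV hRN (hχ1 k) (hCloc₂ k) (fun μ x hx => hAloc₂ k μ x hx) (hψχ k) (hNVcut₂ k)).mono fun y y' =>
      mul_le_mul_of_nonneg_right hRle (Real.exp_nonneg _)
  have hW : ∀ k, HasMaj (BlockNorm.ofBlocks g (liftBlk blk ι)) (BlockNorm.ofBlocks g (liftBlk blk ι)) (commOp (0 : (X × ι → ℝ) →ₗ[ℝ] (X × ι → ℝ)) (fun p : X × ι => hX k p.1) ∘ₗ (projO none ∘ₗ bgPropV (stack (mulOp (fun p : X × ι => χtX k p.1) ∘ₗ N k)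
          (fun j => Sum.elim (fun μ => fgrad η⁻¹ (liftEquiv (τ μ) ι)) (fun μ => bgrad η⁻¹ (liftEquiv (τ μ) ι)) j ∘ₗ (mulOp (fun p : X × ι => χtX k p.1) ∘ₗ N k))) (mulOp (fun p : X × ι => ψX k p.1) ∘ₗ (unstackM (tCoefC η (gaugePair τ fun μ x => coordMat e (ContinuousLinearMap.mulLeftRight ℝ (Matrix m m ℂ) (u k x * U μ x * (u k (τ μ x))ᴴ) (u k x * U μ x * (u k (τ μ x))ᴴ)ᴴ)))
            (tCoefA η (gaugePair τ fun μ x => coordMat e (ContinuousLinearMap.mulLeftRight ℝ (Matrix m m ℂ) (u k x * U μ x * (u k (τ μ x))ᴴ) (u k x * U μ x * (u k (τ μ x))ᴴ)ᴴ))) + NV k ∘ₗ projO none) ∘ₗ mulOp (fun q : (X × ι) × Option (J ⊕ J) => χX k q.1.1))))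
      (fun y y' => ind (Sk k) y * ind (Sk k) y' * (θW * Real.exp (-(ρ₂ * g.dist y y')))) := fun k => by
    rw [show commOp (0 : (X × ι → ℝ) →ₗ[ℝ] (X × ι → ℝ)) (fun p : X × ι => hX k p.1) = 0 from by simp [commOp], LinearMap.zero_comp]
    exact (hasMaj_zero _ _).mono fun y y' => mul_nonneg (mul_nonneg (ind_nonneg _ _) (ind_nonneg _ _)) (mul_nonneg hθW (Real.exp_nonneg _))
  have hW₂ : ∀ k, HasMaj (BlockNorm.ofBlocks g (liftBlk blk ι)) (BlockNorm.ofBlocks g (liftBlk blk ι)) (commOp (0 : (X × ι → ℝ) →ₗ[ℝ] (X × ι → ℝ)) (fun p : X × ι => hX k p.1) ∘ₗ (projO none ∘ₗ bgPropV (stack (mulOp (fun p : X × ι => χtX k p.1) ∘ₗ N k)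
          (fun j => Sum.elim (fun μ => fgrad η⁻¹ (liftEquiv (τ μ) ι)) (fun μ => bgrad η⁻¹ (liftEquiv (τ μ) ι)) j ∘ₗ (mulOp (fun p : X × ι => χtX k p.1) ∘ₗ N k))) (mulOp (fun p : X × ι => ψX k p.1) ∘ₗ (unstackM (tCoefC η (gaugePair τ fun μ x => coordMat e (ContinuousLinearMap.mulLeftRight ℝ (Matrix m m ℂ) (u₂ k x * U₂ μ x * (u₂ k (τ μ x))ᴴ) (u₂ k x * U₂ μ x * (u₂ k (τ μ x))ᴴ)ᴴ)))
            (tCoefA η (gaugePair τ fun μ x => coordMat e (ContinuousLinearMap.mulLeftRight ℝ (Matrix m m ℂ) (u₂ k x * U₂ μ x * (u₂ k (τ μ x))ᴴ) (u₂ k x * U₂ μ x * (u₂ k (τ μ x))ᴴ)ᴴ))) + NV₂ k ∘ₗ projO none) ∘ₗ mulOp (fun q : (X × ι) × Option (J ⊕ J) => χX k q.1.1))))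
      (fun y y' => ind (Sk k) y * ind (Sk k) y' * (θW * Real.exp (-(ρ₂ * g.dist y y')))) := fun k => by
    rw [show commOp (0 : (X × ι → ℝ) →ₗ[ℝ] (X × ι → ℝ)) (fun p : X × ι => hX k p.1) = 0 from by simp [commOp], LinearMap.zero_comp]
    exact (hasMaj_zero _ _).mono fun y y' => mul_nonneg (mul_nonneg (ind_nonneg _ _) (ind_nonneg _ _)) (mul_nonneg hθW (Real.exp_nonneg _))
  have hFX := fun k => hasMaj_mulOp_farDefect_smoothCutDressed blk τ η⁻¹ (Vf := (unstackM (tCoefC η (gaugePair τ fun μ x => coordMat e (ContinuousLinearMap.mulLeftRight ℝ (Matrix m m ℂ) (u k x * U μ x * (u k (τ μ x))ᴴ) (u k x * U μ x * (u k (τ μ x))ᴴ)ᴴ)))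
            (tCoefA η (gaugePair τ fun μ x => coordMat e (ContinuousLinearMap.mulLeftRight ℝ (Matrix m m ℂ) (u k x * U μ x * (u k (τ μ x))ᴴ) (u k x * U μ x * (u k (τ μ x))ᴴ)ᴴ))) + NV k ∘ₗ projO none)) htri hd hrow hσ hβ hβ₁ hct hR hcr hσρ hρ₁V hρ₁G hρ₂ hρ₂₁ (hχt k) (hdχt k) (hdχtb k) (hsub k) (hχ k) (hs k)
    (hsb k) (hdd k) (hddb k) (hs' k) (hsb' k) (hdd' k) (hddb' k) (hcut k) (hcutF k) (hcutB k) (hV k) hq (hhψ k) ρ₃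
  have hFX₂ := fun k => hasMaj_mulOp_farDefect_smoothCutDressed blk τ η⁻¹ (Vf := (unstackM (tCoefC η (gaugePair τ fun μ x => coordMat e (ContinuousLinearMap.mulLeftRight ℝ (Matrix m m ℂ) (u₂ k x * U₂ μ x * (u₂ k (τ μ x))ᴴ) (u₂ k x * U₂ μ x * (u₂ k (τ μ x))ᴴ)ᴴ)))
            (tCoefA η (gaugePair τ fun μ x => coordMat e (ContinuousLinearMap.mulLeftRight ℝ (Matrix m m ℂ) (u₂ k x * U₂ μ x * (u₂ k (τ μ x))ᴴ) (u₂ k x * U₂ μ x * (u₂ k (τ μ x))ᴴ)ᴴ))) + NV₂ k ∘ₗ projO none)) htri hd hrow hσ hβ hβ₁ hct hR hcr hσρ hρ₁V hρ₁G hρ₂ hρ₂₁ (hχt k) (hdχt k) (hdχtb k) (hsub k) (hχ k) (hs k)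
    (hsb k) (hdd k) (hddb k) (hs' k) (hsb' k) (hdd' k) (hddb' k) (hcut k) (hcutF k) (hcutB k) (hV₂ k) hq (hhψ k) ρ₃
  have hFK := fun k => hasMaj_commOp_farDefect_structural blk τ η⁻¹ (NV := NV k)
    (Cc := tCoefC η (gaugePair τ fun μ x => coordMat e (ContinuousLinearMap.mulLeftRight ℝ (Matrix m m ℂ) (u k x * U μ x * (u k (τ μ x))ᴴ) (u k x * U μ x * (u k (τ μ x))ᴴ)ᴴ)))
    (Ac := tCoefA η (gaugePair τ fun μ x => coordMat e (ContinuousLinearMap.mulLeftRight ℝ (Matrix m m ℂ) (u k x * U μ x * (u k (τ μ x))ᴴ) (u k x * U μ x * (u k (τ μ x))ᴴ)ᴴ))) htri hd hrow hσ hβ hβ₁ hct hR hcr hσρ hρ₁V hρ₁G hρ₂ hρ₂₁ (hSχ k) (hSψ k) (hχt k) (hdχt k) (hdχtb k) (hsub k) (hχ k) (hs k)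
    (hsb k) (hdd k) (hddb k) (hs' k) (hsb' k) (hdd' k) (hddb' k) (hNψ k) (hcut k) (hcutF k) (hcutB k) (hV k) hq hθF hρ₃ hρ₃₂ hρF (hhabs k) (hhψ k) (hχh k) (hhs' k) (hhsb' k) (hhdd' k)
    (hhddb' k) (hψχ k) (hfarN k)
  have hFK₂ := fun k => hasMaj_commOp_farDefect_structural blk τ η⁻¹ (NV := NV₂ k)
    (Cc := tCoefC η (gaugePair τ fun μ x => coordMat e (ContinuousLinearMap.mulLeftRight ℝ (Matrix m m ℂ) (u₂ k x * U₂ μ x * (u₂ k (τ μ x))ᴴ) (u₂ k x * U₂ μ x * (u₂ k (τ μ x))ᴴ)ᴴ)))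
    (Ac := tCoefA η (gaugePair τ fun μ x => coordMat e (ContinuousLinearMap.mulLeftRight ℝ (Matrix m m ℂ) (u₂ k x * U₂ μ x * (u₂ k (τ μ x))ᴴ) (u₂ k x * U₂ μ x * (u₂ k (τ μ x))ᴴ)ᴴ))) htri hd hrow hσ hβ hβ₁ hct hR hcr hσρ hρ₁V hρ₁G hρ₂ hρ₂₁ (hSχ k) (hSψ k) (hχt k) (hdχt k) (hdχtb k) (hsub k) (hχ k) (hs k)
    (hsb k) (hdd k) (hddb k) (hs' k) (hsb' k) (hdd' k) (hddb' k) (hNψ k) (hcut k) (hcutF k) (hcutB k) (hV₂ k) hq hθF hρ₃ hρ₃₂ hρF (hhabs k) (hhψ k) (hχh k) (hhs' k) (hhsb' k) (hhdd' k)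
    (hhddb' k) (hψχ k) (hfarN₂ k)
  have hθF' : 0 ≤ θF * (1 * ((β + (β₁ + ct * β)) * (1 - (β + (β₁ + ct * β)) * (R * cr) * cr)⁻¹)) * cr := by positivity
  -- the UNWEAKENED cut-perturbation letters (the closeness radius `r_V(1 + |J ⊕ J|) + R_N`)
  have hVc := fun k => hasMaj_cutPert_structural_of_local blk hd0 hrV hRN (hχ1 k) (hCloc k) (fun μ x hx => hAloc k μ x hx) (hψχ k) (hNVcut k)
  have hVc₂ := fun k => hasMaj_cutPert_structural_of_local blk hd0 hrV hRN (hχ1 k) (hCloc₂ k) (fun μ x hx => hAloc₂ k μ x hx) (hψχ k) (hNVcut₂ k)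
  -- off `Far` the site gauges agree
  have hWW : ∀ k, ¬Far k → (fun x => coordMat e (ContinuousLinearMap.mulLeftRight ℝ (Matrix m m ℂ) (u₂ k x) (u₂ k x)ᴴ)) = (fun x => coordMat e (ContinuousLinearMap.mulLeftRight ℝ (Matrix m m ℂ) (u k x) (u k x)ᴴ)) := fun k hk => by
    funext x; rw [huu k hk]
  have hfin := hasMaj_comp_glueInv_sub_smoothCutDressed_localGauges_close blk τ η⁻¹ Far Z dZ htri hd hd0 hsymm hdZ hdZ0 hrow hσ hβ hβ₁ hct hR hε₀ hcr hNov hσρ hρ₁V hρ₁G hρ₂ hρ₂₁ hρ₂T hρ₃ hρ₃₂ hρ₃V hρ₃N hσρ₃ hε hc₁ hc₂ hθW hcN hℓ hω hd₁ hSχ hSψ hχt hdχt hdχtb hsub hχ hs hsb hdd hddb hs' hsb' hdd' hddb' hNψ hcut hcutF hcutB hhabs hhcut hh1 hh1b hh2 hLip hrh hstep hN hT hV hq hW hKN hug hug' hθF' (le_refl (0:ℝ)) hcov hFK hFX hq'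
    hV₂ hW₂ hug₂ hug₂' hcov₂ hFK₂ hFX₂ hZ hWW (by positivity) hRle (fun k _ => hVc k) (fun k _ => hVc₂ k) jj hcs hcd hrP hρP hvg'
    hDcov hDleib hhs hdh hPsp hPfar hvg₂' hDcov₂ hDleib₂ hPsp₂ hPfar₂ hvv
  exact hfin

end Summit.QuantumFields.YangMills.BalabanUVNodes.N15.CurvedSpecies

end
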